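import Literature.IUT.HodgeArakelov.CohomologySystemOfContH1
import Literature.AnabelianGeometry.EtaleTheta.ContH1ConjAction

/-!
# Functoriality of `H¹` and of its direct limit in compatible AUTOMORPHISM pairs (the action of `ι`)

F14-a continuation / support piece of GAP row G-w4d010-2 (a) (plan/GAP-LEDGER.md): "`ρ : D.coh.H1 ⊤ ≃+ D.coh.H1 ⊤`,
`ρlim : D.coh.lim ≃+ D.coh.lim` with `D.coh.toLim ⊤ ∘ ρ = ρlim ∘ D.coh.toLim ⊤` (= THE action of `ι` on
`H¹(Π_Ÿ(Π), (l·Δ_Θ)(Π))`; `CohomologySystem` carries no `Aut(Π)`-functoriality, audit note F4c)". S. Mochizuki,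
*Inter-universal Teichmüller theory II*, kurims manuscript (Dec. 2020): Cor. 1.12 (i) p. 57 ("`ι` induces an
'action up to torsion' …") over Prop. 1.4 p. 27; Prop. 2.2 (ii) p. 66 ("the condition of invariance with respect to
`ι`"); the action of automorphisms on `H¹` is transport of structure ([EtTh] Prop. 1.5 (iii) p. 23 uses the inner
case, L2's `ContH1.conj`).

Over the instantiation `cohomologySystemOfContH1` (p411226) this file CONSTRUCTS that functoriality for an
AUTOMORPHISM PAIR `(α, β)` — `α : G ≃ G` (the automorphism of `Π`, e.g. a representative of a pointed inversion
`ι`), `β : G' ≃ G'` (its companion on the coefficient ambient, e.g. on `(Π^tp_X)^Θ`), with `β ∘ φ = φ ∘ α` and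
`β(A) ⊆ A` — which is the consumer's INPUT (nothing about `ι` is asserted here):
* `ContH1Aut.autFun/autCocycle/autMap : H¹(H, A) → H¹(H', A)` for `α⁻¹(H') ⊆ H` (cocycle `f ↦ β ∘ f ∘ α⁻¹`;
  the inner case `α = conj σ`, `β = conj φ(σ)` is L2's `ContH1.conj`), `autMap_mk`, naturality `res_autMap`;
* at the limit, for `α` stabilising `H`: `h1LimAut : h1Lim φ A H ⊥ →+ h1Lim φ A H ⊥` (reindexing `K ↦ α(K)` over
  finite-index open `K` — `Idx.mapAut`; index and openness are preserved), `h1LimAut_of`; on `H¹(H ⊓ ⊤, A)`: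
  `h1TopAut`; and the printed compatibility square `toLim ∘ h1TopAut = h1LimAut ∘ toLim` (`toLim_h1TopAut`,
  through `h1EquivOfFiniteIndexOpen`).
A construction over Mathlib + the landed files; claim key of the interface `Mochizuki2012` (disputed); nothing
of [IUTchII] is asserted.
-/

namespace Literature.IUT.HodgeArakelov

open Literature.AnabelianGeometry.EtaleTheta CohomologySystemOfContH1

universe u

noncomputable section

namespace ContH1Aut

variable {G : Type u} {G' : Type u} [Group G] [TopologicalSpace G]
  [Group G'] [TopologicalSpace G'] [IsTopologicalGroup G']
  (φ : G →* G') (A : Subgroup G') [A.Normal] [IsMulCommutative A]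

/-- `β` restricted to the coefficients `A`, as a group endomorphism of `A` (for `β(A) ⊆ A`).
[cite: NeukirchSchmidtWingberg2008, I §5] -/
def coeffMap (β : G' ≃ₜ* G') (hA : ∀ a : G', a ∈ A → β a ∈ A) : A →* A where
  toFun a := ⟨β a, hA a a.2⟩
  map_one' := Subtype.ext (by simp)
  map_mul' a b := Subtype.ext (by simp)

omit [IsTopologicalGroup G'] [A.Normal] [IsMulCommutative A] in
/-- `coeffMap`, coerced to `G'`. [cite: NeukirchSchmidtWingberg2008, I §5] -/
@[simp] theorem coe_coeffMap (β : G' ≃ₜ* G') (hA : ∀ a : G', a ∈ A → β a ∈ A) (a : A) :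
    ((coeffMap A β hA a : A) : G') = β a := rfl

omit [IsTopologicalGroup G'] [A.Normal] [IsMulCommutative A] in
/-- `coeffMap` is continuous. [cite: NeukirchSchmidtWingberg2008, I §5] -/
theorem continuous_coeffMap (β : G' ≃ₜ* G') (hA : ∀ a : G', a ∈ A → β a ∈ A) :
    Continuous (coeffMap A β hA) :=
  Continuous.subtype_mk (β.continuous.comp continuous_subtype_val) _

/-- The transported function `β ∘ f ∘ α⁻¹ : H' → A` of a cocycle `f` on `H` (`α⁻¹(H') ⊆ H`).
[cite: NeukirchSchmidtWingberg2008, I §5] -/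
def autFun (α : G ≃ₜ* G) (β : G' ≃ₜ* G') (hA : ∀ a : G', a ∈ A → β a ∈ A)
    {H H' : Subgroup G} (hH : ∀ x, x ∈ H' → α.symm x ∈ H) (f : contCocycles φ A H) : H' → A :=
  fun x => coeffMap A β hA (f.1 ⟨α.symm (x : G), hH x x.2⟩)

/-- `autFun`, coerced to `G'`. [cite: NeukirchSchmidtWingberg2008, I §5] -/
theorem coe_autFun (α : G ≃ₜ* G) (β : G' ≃ₜ* G') (hA : ∀ a : G', a ∈ A → β a ∈ A)
    {H H' : Subgroup G} (hH : ∀ x, x ∈ H' → α.symm x ∈ H) (f : contCocycles φ A H) (x : H') :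
    ((autFun φ A α β hA hH f x : A) : G') = β (f.1 ⟨α.symm (x : G), hH x x.2⟩ : G') := rfl

/-- `autFun f` is a continuous cocycle (uses `β ∘ φ = φ ∘ α`). [cite: NeukirchSchmidtWingberg2008, I §5] -/
theorem autFun_mem (α : G ≃ₜ* G) (β : G' ≃ₜ* G') (hφ : ∀ g, β (φ g) = φ (α g))
    (hA : ∀ a : G', a ∈ A → β a ∈ A) {H H' : Subgroup G} (hH : ∀ x, x ∈ H' → α.symm x ∈ H) (f : contCocycles φ A H) :
    autFun φ A α β hA hH f ∈ contCocycles φ A H' := by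
  refine ⟨(continuous_coeffMap A β hA).comp (f.2.1.comp (Continuous.subtype_mk
      (α.symm.continuous.comp continuous_subtype_val) _)), fun x y => ?_⟩
  apply Subtype.ext
  have hxy : (⟨α.symm ((x * y : H') : G), hH _ (x * y).2⟩ : H) =
      ⟨α.symm (x : G), hH _ x.2⟩ * ⟨α.symm (y : G), hH _ y.2⟩ :=
    Subtype.ext (by simp)
  rw [Subgroup.coe_mul, MulAut.conjNormal_apply, coe_autFun, coe_autFun, coe_autFun, hxy, f.2.2,
    Subgroup.coe_mul, MulAut.conjNormal_apply]
  simp only [map_mul, map_inv, hφ, ContinuousMulEquiv.apply_symm_apply]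

/-- Transport of cocycles along the automorphism pair `(α, β)`: `f ↦ β ∘ f ∘ α⁻¹`, a group homomorphism
`Z¹(H, A) → Z¹(H', A)`. [cite: NeukirchSchmidtWingberg2008, I §5] -/
def autCocycle (α : G ≃ₜ* G) (β : G' ≃ₜ* G') (hφ : ∀ g, β (φ g) = φ (α g))
    (hA : ∀ a : G', a ∈ A → β a ∈ A) {H H' : Subgroup G} (hH : ∀ x, x ∈ H' → α.symm x ∈ H) :
    contCocycles φ A H →* contCocycles φ A H' where
  toFun f := ⟨autFun φ A α β hA hH f, autFun_mem φ A α β hφ hA hH f⟩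
  map_one' := by
    apply Subtype.ext; funext x; apply Subtype.ext
    rw [coe_autFun]; simp
  map_mul' f g := by
    apply Subtype.ext; funext x; apply Subtype.ext
    change ((autFun φ A α β hA hH (f * g) x : A) : G') =
      ((autFun φ A α β hA hH f x : A) : G') * ((autFun φ A α β hA hH g x : A) : G')
    rw [coe_autFun, coe_autFun, coe_autFun]
    simp

/-- `autCocycle`, evaluated. [cite: NeukirchSchmidtWingberg2008, I §5] -/
theorem coe_autCocycle_apply (α : G ≃ₜ* G) (β : G' ≃ₜ* G') (hφ : ∀ g, β (φ g) = φ (α g))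
    (hA : ∀ a : G', a ∈ A → β a ∈ A) {H H' : Subgroup G} (hH : ∀ x, x ∈ H' → α.symm x ∈ H) (f : contCocycles φ A H) (x : H') :
    (((autCocycle φ A α β hφ hA hH f).1 x : A) : G') = β (f.1 ⟨α.symm (x : G), hH x x.2⟩ : G') := rfl

/-- **Functoriality of `H¹` in the automorphism pair `(α, β)`**: `H¹(H, A) → H¹(H', A)` (coboundaries go to
coboundaries: `∂a ↦ ∂(β a)`). [cite: NeukirchSchmidtWingberg2008, I §5] -/
def autMap (α : G ≃ₜ* G) (β : G' ≃ₜ* G') (hφ : ∀ g, β (φ g) = φ (α g))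
    (hA : ∀ a : G', a ∈ A → β a ∈ A) {H H' : Subgroup G} (hH : ∀ x, x ∈ H' → α.symm x ∈ H) :
    ContH1 φ A H →* ContH1 φ A H' :=
  QuotientGroup.map _ _ (autCocycle φ A α β hφ hA hH) (by
    intro f hf
    obtain ⟨a, ha⟩ := (mem_contCoboundaries_iff _).mp (Subgroup.mem_subgroupOf.mp hf)
    refine Subgroup.mem_subgroupOf.mpr ((mem_contCoboundaries_iff _).mpr ⟨coeffMap A β hA a, ?_⟩)
    funext x
    apply Subtype.ext
    rw [coe_autCocycle_apply, ha]
    simp only [Subgroup.coe_mul, Subgroup.coe_inv, MulAut.conjNormal_apply,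
      map_mul, map_inv, hφ, ContinuousMulEquiv.apply_symm_apply, coe_coeffMap])

/-- `autMap` on classes. [cite: NeukirchSchmidtWingberg2008, I §5] -/
theorem autMap_mk (α : G ≃ₜ* G) (β : G' ≃ₜ* G') (hφ : ∀ g, β (φ g) = φ (α g))
    (hA : ∀ a : G', a ∈ A → β a ∈ A) {H H' : Subgroup G} (hH : ∀ x, x ∈ H' → α.symm x ∈ H) (f : contCocycles φ A H) :
    autMap φ A α β hφ hA hH (QuotientGroup.mk f) = QuotientGroup.mk (autCocycle φ A α β hφ hA hH f) := rfl

/-- NATURALITY of `autMap` with restriction: for `H₁ ≤ H₂`, `H₁' ≤ H₂'` (with `α⁻¹(H_i') ⊆ H_i`),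
`res ∘ autMap = autMap ∘ res`. [cite: NeukirchSchmidtWingberg2008, I §5] -/
theorem res_autMap (α : G ≃ₜ* G) (β : G' ≃ₜ* G') (hφ : ∀ g, β (φ g) = φ (α g))
    (hA : ∀ a : G', a ∈ A → β a ∈ A) {H₁ H₂ H₁' H₂' : Subgroup G} (h : H₁ ≤ H₂) (h' : H₁' ≤ H₂')
    (hH₁ : ∀ x, x ∈ H₁' → α.symm x ∈ H₁) (hH₂ : ∀ x, x ∈ H₂' → α.symm x ∈ H₂) (x : ContH1 φ A H₂) :
    ContH1.res φ A h' (autMap φ A α β hφ hA hH₂ x) = autMap φ A α β hφ hA hH₁ (ContH1.res φ A h x) := by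
  induction x using QuotientGroup.induction_on with
  | H f => rfl

end ContH1Aut

/-! ## The limit: reindexing finite-index open subgroups along `α` -/

namespace CohomologySystemOfContH1

variable {P : TopGroup.{u}} (α : P ≃ₜ* P)

/-- Finite index is preserved by `α`. [cite: Mochizuki2012, Prop 1.4 p.27] -/
theorem finiteIndex_map (K : Subgroup P) [K.FiniteIndex] : (K.map α.toMulEquiv.toMonoidHom).FiniteIndex :=
  Subgroup.finiteIndex_iff.mpr (by
    rw [Subgroup.index_map_of_bijective (f := α.toMulEquiv.toMonoidHom) α.toMulEquiv.bijective K]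
    exact Subgroup.FiniteIndex.index_ne_zero)

/-- Openness is preserved by `α`. [cite: Mochizuki2012, Prop 1.4 p.27] -/
theorem isOpen_map (K : Subgroup P) (hK : IsOpen (K : Set P)) :
    IsOpen ((K.map α.toMulEquiv.toMonoidHom : Subgroup P) : Set P) := by
  rw [Subgroup.map_equiv_eq_comap_symm']
  exact hK.preimage α.symm.continuous

/-- `α` carries a finite-index open subgroup to a finite-index open subgroup: the index map `K ↦ α(K)` on
`Idx ⊥`. [cite: Mochizuki2012, Prop 1.4 p.27] -/
def Idx.mapAut (i : Idx (P := P) ⊥) : Idx (P := P) ⊥ :=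
  OrderDual.toDual ⟨i.K.map α.toMulEquiv.toMonoidHom,
    (by haveI := (OrderDual.ofDual i).2.1; exact finiteIndex_map α i.K),
    isOpen_map α i.K (OrderDual.ofDual i).2.2.1, bot_le⟩

/-- Underlying subgroup of `Idx.mapAut`. [cite: Mochizuki2012, Prop 1.4 p.27] -/
@[simp] theorem Idx.K_mapAut (i : Idx (P := P) ⊥) :
    (Idx.mapAut α i).K = i.K.map α.toMulEquiv.toMonoidHom := rfl

/-- `Idx.mapAut` is monotone (`K_j ⊆ K_i ⇒ α K_j ⊆ α K_i`). [cite: Mochizuki2012, Prop 1.4 p.27] -/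
theorem Idx.mapAut_mono {i j : Idx (P := P) ⊥} (hij : i ≤ j) : Idx.mapAut α i ≤ Idx.mapAut α j :=
  Subgroup.map_mono (Idx.le_iff.mp hij)

end CohomologySystemOfContH1

section Limit

variable {P : TopGroup.{u}} {G' : Type u} [Group G'] [TopologicalSpace G'] [IsTopologicalGroup G']
  (φ : P →* G') (A : Subgroup G') [A.Normal] [IsMulCommutative A] (H : Subgroup P)
  (α : P ≃ₜ* P) (β : G' ≃ₜ* G') (hφ : ∀ g, β (φ g) = φ (α g)) (hA : ∀ a : G', a ∈ A → β a ∈ A)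
  (hH : ∀ x, x ∈ H ↔ α x ∈ H)

omit [IsTopologicalGroup G'] [A.Normal] [IsMulCommutative A] in
/-- `α⁻¹(H ⊓ α K) ⊆ H ⊓ K` for `α` stabilising `H`. [cite: Mochizuki2012, Prop 1.4 p.27] -/
theorem symm_mem_inf (hH : ∀ x, x ∈ H ↔ α x ∈ H) (K : Subgroup P) (x : P)
    (hx : x ∈ H ⊓ K.map α.toMulEquiv.toMonoidHom) : α.symm x ∈ H ⊓ K := by
  refine Subgroup.mem_inf.mpr ⟨?_, Subgroup.mem_map_equiv.mp (Subgroup.mem_inf.mp hx).2⟩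
  refine (hH (α.symm x)).mpr ?_
  rw [ContinuousMulEquiv.apply_symm_apply]
  exact (Subgroup.mem_inf.mp hx).1

/-- The member maps of the limit automorphism: `H¹(H ⊓ K, A) → H¹(H ⊓ α K, A) → lim`.
[cite: Mochizuki2012, Prop 1.4 p.27] -/
def h1LimAutComponent (i : Idx (P := P) ⊥) : Gmod φ A H ⊥ i →+ h1Lim φ A H ⊥ :=
  (h1Of φ A H ⊥ (Idx.mapAut α i)).comp
    (MonoidHom.toAdditive (ContH1Aut.autMap φ A α β hφ hA (symm_mem_inf H α hH i.K)))

/-- **The action of the automorphism pair `(α, β)` on the limit** `lim_K H¹(H|_K, A)` (`α` stabilising `H`),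
by the universal property (DEFINED). [cite: Mochizuki2012, Cor 1.12 (i) p.57] -/
def h1LimAut : h1Lim φ A H ⊥ →+ h1Lim φ A H ⊥ :=
  AddCommGroup.DirectLimit.lift (Gmod φ A H ⊥) (fmod φ A H ⊥) (h1Lim φ A H ⊥)
    (h1LimAutComponent φ A H α β hφ hA hH)
    (fun i j hij x => by
      have key : ∀ z, ContH1Aut.autMap φ A α β hφ hA (symm_mem_inf H α hH j.K)
            (ContH1.res φ A (inf_le_inf_left H (Idx.le_iff.mp hij)) z) =
          ContH1.res φ A (inf_le_inf_left H (Idx.le_iff.mp (Idx.mapAut_mono α hij)))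
            (ContH1Aut.autMap φ A α β hφ hA (symm_mem_inf H α hH i.K) z) :=
        fun z => (ContH1Aut.res_autMap φ A α β hφ hA _ _ _ _ z).symm
      calc h1LimAutComponent φ A H α β hφ hA hH j (fmod φ A H ⊥ i j hij x)
          = h1Of φ A H ⊥ (Idx.mapAut α j) (fmod φ A H ⊥ (Idx.mapAut α i) (Idx.mapAut α j)
              (Idx.mapAut_mono α hij)
              (Additive.ofMul (ContH1Aut.autMap φ A α β hφ hA (symm_mem_inf H α hH i.K)
                (Additive.toMul x)))) :=
            congrArg (h1Of φ A H ⊥ (Idx.mapAut α j)) (congrArg Additive.ofMul (key (Additive.toMul x)))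
        _ = h1LimAutComponent φ A H α β hφ hA hH i x := h1Of_fmod φ A H ⊥ (Idx.mapAut_mono α hij) _)

/-- `h1LimAut` on generators. [cite: Mochizuki2012, Cor 1.12 (i) p.57] -/
@[simp] theorem h1LimAut_of (i : Idx (P := P) ⊥) (x : Gmod φ A H ⊥ i) :
    h1LimAut φ A H α β hφ hA hH (h1Of φ A H ⊥ i x) =
      h1Of φ A H ⊥ (Idx.mapAut α i)
        (Additive.ofMul (ContH1Aut.autMap φ A α β hφ hA (symm_mem_inf H α hH i.K) (Additive.toMul x))) :=
  AddCommGroup.DirectLimit.lift_of (G := Gmod φ A H ⊥) (f := fmod φ A H ⊥) _ _ _ i x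

omit [IsTopologicalGroup G'] [A.Normal] [IsMulCommutative A] in
/-- `α⁻¹(H ⊓ ⊤) ⊆ H ⊓ ⊤` for `α` stabilising `H`. [cite: Mochizuki2012, Prop 1.4 p.27] -/
theorem symm_mem_inf_top (hH : ∀ x, x ∈ H ↔ α x ∈ H) (x : P) (hx : x ∈ H ⊓ (⊤ : Subgroup P)) :
    α.symm x ∈ H ⊓ (⊤ : Subgroup P) := by
  refine Subgroup.mem_inf.mpr ⟨?_, Subgroup.mem_top _⟩
  refine (hH (α.symm x)).mpr ?_
  rw [ContinuousMulEquiv.apply_symm_apply]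
  exact (Subgroup.mem_inf.mp hx).1

/-- **The action on `H¹(H, A)` itself** (the system's `H1 ⊤`, up to `h1EquivOfFiniteIndexOpen`): transport
along `(α, β)` on `H¹(H ⊓ ⊤, A)`. [cite: Mochizuki2012, Cor 1.12 (i) p.57] -/
def h1TopAut : ContH1 φ A (H ⊓ ⊤) →* ContH1 φ A (H ⊓ ⊤) :=
  ContH1Aut.autMap φ A α β hφ hA (symm_mem_inf_top H α hH)

/-- **The compatibility square** `toLim ∘ ρ = ρlim ∘ toLim` of GAP row G-w4d010-2 (a), at the model: the action
on `H¹(H, A)` and the action on the limit commute with the canonical map (through the comparison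
`H1 ⊤ ≅ H¹(H ⊓ ⊤, A)`). [cite: Mochizuki2012, Cor 1.12 (i) p.57] -/
theorem toLim_h1TopAut (y : Additive (ContH1 φ A (H ⊓ ⊤))) :
    (cohomologySystemOfContH1 φ A H).toLim ⊤
        ((h1EquivOfFiniteIndexOpen φ A H ⊤ inferInstance (by simp)).symm
          (MonoidHom.toAdditive (h1TopAut φ A H α β hφ hA hH) y)) =
      h1LimAut φ A H α β hφ hA hH
        ((cohomologySystemOfContH1 φ A H).toLim ⊤
          ((h1EquivOfFiniteIndexOpen φ A H ⊤ inferInstance (by simp)).symm y)) := by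
  rw [toLim_h1Equiv_symm, toLim_h1Equiv_symm, h1LimAut_of]
  -- the two indices `⊤` and `α ⊤ (= ⊤)`: compare through `of_f` along `⊤ ≤ α ⊤` in `Idx ⊥`
  set i₀ : Idx (P := P) ⊥ := (Idx.self (P := P) ⊤ inferInstance (by simp)).incl bot_le with hi₀
  have htop : i₀.K.map α.toMulEquiv.toMonoidHom = (⊤ : Subgroup P) := by
    change (⊤ : Subgroup P).map α.toMulEquiv.toMonoidHom = ⊤
    rw [Subgroup.map_equiv_eq_comap_symm']
    exact Subgroup.comap_top _
  have hle : i₀ ≤ Idx.mapAut α i₀ := by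
    change (Idx.mapAut α i₀).K ≤ i₀.K
    rw [Idx.K_mapAut, htop]
    exact le_top
  have step : fmod φ A H ⊥ i₀ (Idx.mapAut α i₀) hle (MonoidHom.toAdditive (h1TopAut φ A H α β hφ hA hH) y) =
      Additive.ofMul (ContH1Aut.autMap φ A α β hφ hA (symm_mem_inf H α hH i₀.K) (Additive.toMul y)) :=
    congrArg Additive.ofMul
      ((ContH1Aut.res_autMap φ A α β hφ hA (le_refl _) _ (symm_mem_inf H α hH i₀.K)
          (symm_mem_inf_top H α hH) (Additive.toMul y)).trans
        (congrArg _ (CohomologySystemOfContH1.res_refl_apply φ A (Additive.toMul y))))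
  calc h1Of φ A H ⊥ i₀ (MonoidHom.toAdditive (h1TopAut φ A H α β hφ hA hH) y)
      = h1Of φ A H ⊥ (Idx.mapAut α i₀) (fmod φ A H ⊥ i₀ (Idx.mapAut α i₀) hle
          (MonoidHom.toAdditive (h1TopAut φ A H α β hφ hA hH) y)) := (h1Of_fmod φ A H ⊥ hle _).symm
    _ = h1Of φ A H ⊥ (Idx.mapAut α i₀)
          (Additive.ofMul (ContH1Aut.autMap φ A α β hφ hA (symm_mem_inf H α hH i₀.K) (Additive.toMul y))) := by
        rw [step]; exact rfl

end Limit


/-! ## v2 (append-only): equivariance of the transport with respect to CONJUGATION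

For GAP row G-w4d010-2 (b) ("`ρ` maps the orbit onto the orbit"): the transport `autMap` along `(α, β)`
intertwines L2's conjugation action `ContH1.conj σ` with `ContH1.conj (α σ)`. Hence an automorphism pair maps
the `Π`-conjugacy orbit of a class onto the `Π`-conjugacy orbit of its image (so (b) reduces to: the image of the
chosen root class lies in the orbit — the [EtTh] content, not proved here). [cite: NeukirchSchmidtWingberg2008, I §5] -/

namespace ContH1Aut

variable {G : Type u} {G' : Type u} [Group G] [TopologicalSpace G] [IsTopologicalGroup G]
  [Group G'] [TopologicalSpace G'] [IsTopologicalGroup G']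
  (φ : G →* G') (A : Subgroup G') [A.Normal] [IsMulCommutative A]

/-- **Equivariance**: `autMap (conj σ x) = conj (α σ) (autMap x)` for `x ∈ H¹(H, A)`, `H ⊴ G`, `H' ⊴ G`,
`α⁻¹(H') ⊆ H`. [cite: NeukirchSchmidtWingberg2008, I §5] -/
theorem autMap_conj (α : G ≃ₜ* G) (β : G' ≃ₜ* G') (hφ : ∀ g, β (φ g) = φ (α g))
    (hA : ∀ a : G', a ∈ A → β a ∈ A) {H H' : Subgroup G} [H.Normal] [H'.Normal]
    (hH : ∀ x, x ∈ H' → α.symm x ∈ H) (σ : G) (x : ContH1 φ A H) :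
    autMap φ A α β hφ hA hH (ContH1.conj φ A σ x) = ContH1.conj φ A (α σ) (autMap φ A α β hφ hA hH x) := by
  induction x using QuotientGroup.induction_on with
  | H f =>
    rw [ContH1.conj_mk, autMap_mk, autMap_mk, ContH1.conj_mk]
    congr 1
    apply Subtype.ext; funext y; apply Subtype.ext
    rw [coe_autCocycle_apply, ContH1.conjCocycle_apply, ContH1.conjCocycle_apply, MulAut.conjNormal_apply,
      MulAut.conjNormal_apply, coe_autCocycle_apply]
    have hy : (MulAut.conjNormal σ⁻¹ (⟨α.symm (y : G), hH y y.2⟩ : H) : H) =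
        ⟨α.symm ((MulAut.conjNormal (α σ)⁻¹ y : H') : G), hH _ (MulAut.conjNormal (α σ)⁻¹ y).2⟩ := by
      apply Subtype.ext
      simp only [map_inv, MulAut.conjNormal_inv_apply, map_mul, ContinuousMulEquiv.symm_apply_apply]
    rw [hy]
    simp only [map_mul, map_inv, hφ]

/-- Consequently an automorphism pair maps `G`-conjugacy ORBITS onto `G`-conjugacy orbits: the image of the
orbit of `x` is the orbit of the image of `x`. [cite: NeukirchSchmidtWingberg2008, I §5] -/
theorem autMap_image_orbit (α : G ≃ₜ* G) (β : G' ≃ₜ* G') (hφ : ∀ g, β (φ g) = φ (α g))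
    (hA : ∀ a : G', a ∈ A → β a ∈ A) {H H' : Subgroup G} [H.Normal] [H'.Normal]
    (hH : ∀ x, x ∈ H' → α.symm x ∈ H) (x : ContH1 φ A H) :
    autMap φ A α β hφ hA hH '' {y | ∃ σ : G, y = ContH1.conj φ A σ x} =
      {y | ∃ σ : G, y = ContH1.conj φ A σ (autMap φ A α β hφ hA hH x)} := by
  ext y
  constructor
  · rintro ⟨z, ⟨σ, rfl⟩, rfl⟩
    exact ⟨α σ, autMap_conj φ A α β hφ hA hH σ x⟩
  · rintro ⟨τ, rfl⟩
    refine ⟨ContH1.conj φ A (α.symm τ) x, ⟨α.symm τ, rfl⟩, ?_⟩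
    rw [autMap_conj, ContinuousMulEquiv.apply_symm_apply]

end ContH1Aut

end

end Literature.IUT.HodgeArakelov
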